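import Literature.Computability.QuantumComplexity.CliffordSuffixStabilizerCount
import HarnessLib

/-!
# First-moment blindness behind one sweep of single-qubit π/2 X-rotations, on every register

Register `ι → Bool` (`n = |ι|` qubits), the typed Pauli-path model of the sibling modules
(`DampingCleanSuffixProfile`: sector transmissivity `π_C(P) = sectorTrans`, input-leg profile
`V_k(C) = inputProfile`, first-moment certificate `Ψ_C(q) = Σ_k q^{2k} V_k(C)` with the sandwich
`profile_sandwich`; `CleanSuffixProfileExtremes`: one-layer extremes; `CliffordSuffixStabilizerCount`:
image tracking through any-depth signed-permutation suffixes (`sectorTrans_conj_path`), the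
stabiliser-intersection count `Σ_k V_k(C) = |𝒵 ∩ Φ_C⁻¹𝒵|` at `r = 0` (`profileMass_zero_eq_card`), the
uniform-hit average (`family_profileMass`, `avg_certificate_le_of_mass`), the string rotations
`rot Q = exp(−iπ/4·σ_Q)` and the typed two-qubit witnesses `vx`, `fam5`).

This module removes the restriction `n = 2` of the sibling's witnesses. The clean suffix `xSweep e`
applies `R_{X_{e t}} = exp(−iπ/4·X_{e t})` at step `t` along any enumeration `e : Fin d → ι` of the
sites (bijective `e`: every site exactly once; the composite is the product layer `⊗_i exp(−iπ/4 X_i)` of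
single-qubit Cliffords — no entangling gate; at `n = 2` it is the sibling's `V`, `vx_eq_sweep_comp`).

* **S8/1** `rot_xSite_conj`: `R_{X_i} σ_R R_{X_i}† = xPhase(R_i)·σ_{R[i ↦ vxLetter R_i]}` for EVERY string `R`
  (signed letter permutation `Z ↦ −Y ↦ −Z` at site `i`), via the sibling's `rot_conj_of_comm/anti` and the
  string product `pauliString_mul_xSite`; `sweepPath_conj`: the sweep meets the tracked-image interface
  of the sibling's §2–§3 with path `sweepPath` and unit phases `xPhase`.
* **S8/2** `sweep_sectorTrans_eq_zero`: every non-identity diagonal sector has `π_C(P) = 0` behind a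
  bijective sweep, at every rate `r`; `sweep_certificate_eq_one`: **`Ψ_C(q) = 1` identically — every
  register size, rate, letter and read-out string**; `sweep_profileMass_eq_one`: the count
  `|𝒵 ∩ Φ_C⁻¹𝒵|` is `1`.
* **S8/3** the family `{1} ∪ {sweep} × m` (`sweepFam`): `sweepFam_uniform_hits` (every non-identity
  diagonal string keeps a diagonal image for exactly `b = 1` member), `sweepFam_profileMass`
  (`Σ_j Σ_k V_k = (m+1) + (2ⁿ−1)`), `sweepFam_avg_certificate_le` (`Σ_j Ψ_j(q) ≤ (m+1) + q²(2ⁿ−1)`),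
  `cliffordValue_avg_certificate_le` (`m = 2ⁿ`: average `≤ 1 + q²(2ⁿ−1)/(2ⁿ+1) < 1 + q²` on every
  register — the VALUE of the uniform-Clifford average by orbit counting (remark) attained by a typed family).

Honest scope — THE CERTIFICATE GOES BLIND, NOT THE CIRCUIT HARD: the sweep is a classically trivial
product layer of single-qubit Cliffords, and every statement below is about the SIZE OF THE
FIRST-MOMENT / JENSEN CERTIFICATE of the
uniform-first-moment route behind clean Clifford-type suffixes (read through [FeffermanEtAl2023] §10's
see-saw discussion): behind one layer of single-qubit π/2 X-rotations it certifies nothing beyond the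
uniform collision value, on every register and at every transmission; behind the family above it
certifies on average `< q²` of excess against `(1+q²)ⁿ − 1` behind a diagonal suffix
([DalzellHunterJonesBrandao2022] Thm 1 contrast of the siblings). NOT treated: second moments /
member-wise collision probabilities, non-Clifford layers, the uniform Clifford MEASURE itself (only the
value `1/(2ⁿ+1)` is matched by the typed family; that this value IS the uniform-Clifford average is an
orbit-counting remark, not typed); no hardness, simulation-cost or second-moment statement is made.
Nothing here proves or refutes quantum advantage (BQP vs BPP untouched); finite identities about the
typed Pauli-path model; no sampler, spoofer or estimator is constructed.
References: [FeffermanEtAl2023] arXiv:2306.16659 §10 (Remarks 20–22), p. 16; [AharonovEtAl2023] STOC 2023,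
§3.1, Lemma 4, Lemma 5, Def. 5; [DalzellHunterJonesBrandao2022] PRX Quantum 3, Thm 1; [KempeEtAl2010] QIC 10, §2.
-/

namespace Literature.Computability.QuantumComplexity.PauliPath.DampingCleanSuffix.Extremes.StabilizerCount.Sweep

open Matrix Finset

/-! ## §1 The sweep of single-qubit π/2 X-rotations on any register -/

section Sweep

variable {ι : Type*} [Fintype ι] [DecidableEq ι]

/-- The weight-one string with `X` at site `i` (the `P := X` case of `singleSite` in
`MinimalWeightLegalPathCount`, which is not imported here to keep the import cone minimal).
[cite: KempeEtAl2010, §2 (Pauli strings); AharonovEtAl2023, Lemma 6 (single-site strings)] -/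
def xSite (i : ι) : ι → Pauli := Function.update (fun _ : ι => Pauli.I) i Pauli.X

omit [Fintype ι] in
/-- [folklore] -/
private theorem xSite_self (i : ι) : xSite i i = Pauli.X := by simp [xSite]

omit [Fintype ι] in
/-- [folklore] -/
private theorem xSite_of_ne {i j : ι} (h : j ≠ i) : xSite i j = Pauli.I := by simp [xSite, h]

/-- The commutation character of a string `R` with `X_i` is the one-site sign `sign X (R i)`.
[cite: KempeEtAl2010, §2 Observation 4] -/
theorem strSign_xSite (i : ι) (R : ι → Pauli) : strSign (xSite i) R = Pauli.sign Pauli.X (R i) := by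
  rw [strSign_eq, Finset.prod_eq_single i (fun j _ hj => by rw [xSite_of_ne hj]; simp [Pauli.sign])
    (fun h => absurd (Finset.mem_univ i) h), xSite_self]

/-- Right multiplication table by `X`: the letter `p·X` up to phase (`I ↦ X`, `X ↦ I`, `Y ↦ Z`, `Z ↦ Y`).
[cite: KempeEtAl2010, §2] -/
def xMulLetter : Pauli → Pauli
  | Pauli.I => Pauli.X
  | Pauli.X => Pauli.I
  | Pauli.Y => Pauli.Z
  | Pauli.Z => Pauli.Y

/-- The phase of `p·X`: `Y·X = −i·Z`, `Z·X = i·Y`. [cite: KempeEtAl2010, §2] -/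
def xMulPhase : Pauli → ℂ
  | Pauli.I => 1
  | Pauli.X => 1
  | Pauli.Y => -Complex.I
  | Pauli.Z => Complex.I

/-- `σ_p σ_X = xMulPhase p · σ_{xMulLetter p}` (one site). [cite: KempeEtAl2010, §2] -/
theorem mat_mul_matX (p : Pauli) : p.mat * Pauli.X.mat = xMulPhase p • (xMulLetter p).mat := by
  ext a b
  cases p <;> cases a <;> cases b <;> simp [Pauli.mul_apply_bool, xMulPhase, xMulLetter]

/-- `σ_R σ_{X_i} = xMulPhase (R i) · σ_{R[i ↦ R_i·X]}`. [cite: KempeEtAl2010, §2] -/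
theorem pauliString_mul_xSite (R : ι → Pauli) (i : ι) :
    pauliString R * pauliString (xSite i) =
      xMulPhase (R i) • pauliString (Function.update R i (xMulLetter (R i))) := by
  rw [pauliString_eq, pauliString_eq, tensorAll_mul]
  have h : (fun j => (R j).mat * (xSite i j).mat) =
      Function.update (fun j => (R j).mat) i (xMulPhase (R i) • (xMulLetter (R i)).mat) := by
    funext j
    by_cases hj : j = i
    · subst hj; rw [Function.update_apply, if_pos rfl, xSite_self, mat_mul_matX]
    · rw [Function.update_apply, if_neg hj, xSite_of_ne hj]
      show (R j).mat * (1 : Matrix Bool Bool ℂ) = (R j).mat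
      rw [Matrix.mul_one]
  rw [h, tensorAll_update_smul, pauliString_eq]
  congr 2
  funext j
  by_cases hj : j = i
  · subst hj; simp
  · simp [hj]

/-- The phase a letter picks up under `R_{X}` conjugation: `Z ↦ −Y` (sign `−1`), `Y ↦ Z`, `I`, `X` fixed.
[cite: KempeEtAl2010, §2 Observation 4] -/
def xPhase : Pauli → ℂ
  | Pauli.Z => -1
  | _ => 1

/-- `|xPhase p| = 1`. [folklore] -/
private theorem norm_xPhase (p : Pauli) : ‖xPhase p‖ = 1 := by
  cases p <;> simp [xPhase]

/-- **S8 (one site).** `R_{X_i} σ_R R_{X_i}† = xPhase(R_i) · σ_{R[i ↦ vxLetter R_i]}`: the π/2 X-rotation at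
site `i` acts on strings as the signed letter permutation `Z ↦ −Y`, `Y ↦ Z` at that site.
[cite: KempeEtAl2010, §2 Observation 4; FeffermanEtAl2023, §10 Remark 20] -/
theorem rot_xSite_conj (i : ι) (R : ι → Pauli) :
    rot (xSite i) * pauliString R * (rot (xSite i))ᴴ =
      xPhase (R i) • pauliString (Function.update R i (vxLetter (R i))) := by
  rcases hR : R i with _ | _ | _ | _
  · have h1 : strSign (xSite i) R = 1 := by rw [strSign_xSite, hR]; simp [Pauli.sign]
    rw [rot_conj_of_comm h1, show vxLetter Pauli.I = R i from hR.symm, Function.update_eq_self]; rfl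
  · have h1 : strSign (xSite i) R = 1 := by rw [strSign_xSite, hR]; simp [Pauli.sign]
    rw [rot_conj_of_comm h1, show vxLetter Pauli.X = R i from hR.symm, Function.update_eq_self]; rfl
  · have h1 : strSign (xSite i) R = -1 := by rw [strSign_xSite, hR]; simp [Pauli.sign]
    rw [rot_conj_of_anti h1, pauliString_mul_xSite, hR, smul_smul]
    simp only [xMulPhase, xMulLetter, xPhase, vxLetter, mul_neg, Complex.I_mul_I, neg_neg]
  · have h1 : strSign (xSite i) R = -1 := by rw [strSign_xSite, hR]; simp [Pauli.sign]
    rw [rot_conj_of_anti h1, pauliString_mul_xSite, hR, smul_smul]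
    simp only [xMulPhase, xMulLetter, xPhase, vxLetter, Complex.I_mul_I]

/-- The clean suffix sweeping the sites in the order `e`: layer `t` is `R_{X_{e t}}` (for a bijective `e`
the composite is the product layer `⊗_i exp(−iπ/4·X_i)`, one single-qubit gate per site).
[cite: FeffermanEtAl2023, §10 Remarks 20–22] -/
noncomputable def xSweep {d : ℕ} (e : Fin d → ι) : Fin d → Matrix (ι → Bool) (ι → Bool) ℂ :=
  fun t => rot (xSite (e t))

/-- The layers of the sweep are unitary. [cite: KempeEtAl2010, §2] -/
theorem xSweep_unitary {d : ℕ} (e : Fin d → ι) (t : Fin d) :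
    xSweep e t ∈ Matrix.unitaryGroup (ι → Bool) ℂ := rot_unitary _

/-- The tracked string path of the sweep: after `t` layers the sites `e 0, …, e (t−1)` carry `vxLetter`.
[cite: FeffermanEtAl2023, §10 Remark 20] -/
def sweepPath {d : ℕ} (e : Fin d → ι) (P : ι → Pauli) : Fin (d + 1) → ι → Pauli :=
  fun t i => if ∃ s : Fin d, s.val < t.val ∧ e s = i then vxLetter (P i) else P i

omit [Fintype ι] in
/-- [folklore] -/
private theorem sweepPath_zero {d : ℕ} (e : Fin d → ι) (P : ι → Pauli) : sweepPath e P 0 = P := by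
  funext i
  simp [sweepPath]

omit [Fintype ι] in
/-- For a surjective sweep the final image is `vxLetter ∘ P`. [folklore] -/
private theorem sweepPath_last {d : ℕ} {e : Fin d → ι} (he : Function.Surjective e) (P : ι → Pauli) :
    sweepPath e P (Fin.last d) = fun i => vxLetter (P i) := by
  funext i
  obtain ⟨s, hs⟩ := he i
  simp only [sweepPath, Fin.val_last]
  rw [if_pos ⟨s, s.isLt, hs⟩]

omit [Fintype ι] in
/-- For an injective sweep, site `e t` is untouched before step `t`. [folklore] -/
private theorem sweepPath_castSucc_apply {d : ℕ} {e : Fin d → ι} (he : Function.Injective e)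
    (P : ι → Pauli) (t : Fin d) : sweepPath e P t.castSucc (e t) = P (e t) := by
  simp only [sweepPath, Fin.val_castSucc]
  rw [if_neg]
  rintro ⟨s, hs, hse⟩
  exact absurd (congrArg Fin.val (he hse)) (Nat.ne_of_lt hs)

omit [Fintype ι] in
/-- The step relation of the path (injective sweep). [folklore] -/
private theorem sweepPath_succ {d : ℕ} {e : Fin d → ι} (he : Function.Injective e) (P : ι → Pauli)
    (t : Fin d) :
    sweepPath e P t.succ =
      Function.update (sweepPath e P t.castSucc) (e t) (vxLetter (sweepPath e P t.castSucc (e t))) := by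
  rw [sweepPath_castSucc_apply he]
  funext i
  by_cases hi : i = e t
  · subst hi
    rw [Function.update_apply, if_pos rfl]
    simp only [sweepPath, Fin.val_succ]
    rw [if_pos ⟨t, Nat.lt_succ_self _, rfl⟩]
  · rw [Function.update_apply, if_neg hi]
    simp only [sweepPath, Fin.val_succ, Fin.val_castSucc]
    have hiff : (∃ s : Fin d, s.val < t.val + 1 ∧ e s = i) ↔ ∃ s : Fin d, s.val < t.val ∧ e s = i := by
      constructor
      · rintro ⟨s, hs, hse⟩
        refine ⟨s, ?_, hse⟩
        rcases Nat.lt_succ_iff_lt_or_eq.1 hs with h | h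
        · exact h
        · exact absurd hse (by rw [Fin.ext h]; exact Ne.symm hi)
      · rintro ⟨s, hs, hse⟩
        exact ⟨s, Nat.lt_succ_of_lt hs, hse⟩
    by_cases h2 : ∃ s : Fin d, s.val < t.val ∧ e s = i
    · rw [if_pos (hiff.2 h2), if_pos h2]
    · rw [if_neg (fun h1 => h2 (hiff.1 h1)), if_neg h2]

/-- **S8 (the sweep meets the tracked-image interface of §2–§3).** Layer `t` conjugates the tracked
string to `xPhase · (next string)`. [cite: FeffermanEtAl2023, §10 Remark 20; KempeEtAl2010, §2 Observation 4] -/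
theorem sweepPath_conj {d : ℕ} {e : Fin d → ι} (he : Function.Injective e) (P : ι → Pauli) (t : Fin d) :
    xSweep e t * pauliString (sweepPath e P t.castSucc) * (xSweep e t)ᴴ =
      xPhase (P (e t)) • pauliString (sweepPath e P t.succ) := by
  rw [xSweep, rot_xSite_conj, sweepPath_castSucc_apply he, sweepPath_succ he, sweepPath_castSucc_apply he]

omit [Fintype ι] [DecidableEq ι] in
/-- A diagonal string whose sitewise `vxLetter` image is diagonal is the identity string. [folklore] -/
private theorem eq_constI_of_vxLetter_diag {P : ι → Pauli} (hZ : ∀ i, P i = Pauli.I ∨ P i = Pauli.Z)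
    (h : ∀ i, vxLetter (P i) = Pauli.I ∨ vxLetter (P i) = Pauli.Z) : P = fun _ => Pauli.I := by
  funext i
  rcases hZ i with hi | hi
  · exact hi
  · rcases h i with h' | h' <;> rw [hi] at h' <;> exact absurd h' (by decide)

/-- **S8 (EVERY NON-IDENTITY DIAGONAL SECTOR IS ROTATED OUT, any register, any rate).** Behind a bijective
sweep of single-qubit π/2 X-rotations `π_C(P) = 0` for every diagonal `P ≠ 1`.
[cite: FeffermanEtAl2023, §10 Remarks 20–22; AharonovEtAl2023, §3.1] -/
theorem sweep_sectorTrans_eq_zero (r : ℝ) {d : ℕ} {e : Fin d → ι} (he : Function.Bijective e)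
    (x₀ : ι → Bool) {P : ι → Pauli} (hZ : ∀ i, P i = Pauli.I ∨ P i = Pauli.Z) (hP : P ≠ fun _ => Pauli.I) :
    sectorTrans r (xSweep e) x₀ P = 0 := by
  have h := sectorTrans_conj_path r (xSweep e) x₀ (sweepPath e P) (fun t => xPhase (P (e t)))
    (sweepPath_conj he.1 P) (fun t => norm_xPhase _)
  rw [sweepPath_zero] at h
  rw [h, sweepPath_last he.2, if_neg (fun h' => hP (eq_constI_of_vxLetter_diag hZ h')), mul_zero]

/-- `V_k = 0` as soon as every diagonal weight-`k` sector has `π_C = 0` (any depth).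
[cite: AharonovEtAl2023, Definition 5 and Lemma 5] -/
theorem inputProfile_eq_zero_of_sectorTrans (r : ℝ) {d : ℕ} (U : Fin d → Matrix (ι → Bool) (ι → Bool) ℂ)
    (x₀ : ι → Bool) (k : ℕ)
    (h : ∀ P : ι → Pauli, (∀ i, P i = Pauli.I ∨ P i = Pauli.Z) → strWeight P = k → sectorTrans r U x₀ P = 0) :
    inputProfile r U x₀ k = 0 := by
  unfold inputProfile
  refine Finset.sum_eq_zero fun P hP => ?_
  rw [Finset.mem_filter] at hP
  rw [norm_sq_trace_pauliString_mul_proj]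
  split_ifs with hZ
  · rw [h P hZ hP.2, mul_zero]
  · rw [zero_mul]

/-- **S8 (TOTAL FIRST-MOMENT BLINDNESS ON EVERY REGISTER).** Behind one sweep of single-qubit π/2
X-rotations (one per site, any order; a product of single-qubit Cliffords, no entangling gate) the
first-moment certificate is IDENTICALLY `1`: `Ψ_C(q) = Σ_k q^{2k} V_k(C) = 1` for every register size,
rate `r`, letter `q` and read-out string `x₀` — the uniform-first-moment / Jensen route certifies exactly the
uniform collision value. A statement about the SIZE of that certificate only.
[cite: FeffermanEtAl2023, §10 Remarks 20 and 22, p. 16 («see-saw»); AharonovEtAl2023, Lemma 4] -/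
theorem sweep_certificate_eq_one (r : ℝ) {d : ℕ} {e : Fin d → ι} (he : Function.Bijective e)
    (x₀ : ι → Bool) (q : ℝ) :
    ∑ k ∈ Finset.range (Fintype.card ι + 1), (q ^ 2) ^ k * inputProfile r (xSweep e) x₀ k = 1 := by
  rw [Finset.sum_eq_single 0 (fun k _ hk => ?_) (fun h => absurd (Finset.mem_range.2 (Nat.succ_pos _)) h),
    pow_zero, one_mul, inputProfile_zero r (U := xSweep e) (xSweep_unitary e)]
  rw [inputProfile_eq_zero_of_sectorTrans r (xSweep e) x₀ k fun P hZ hw =>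
      sweep_sectorTrans_eq_zero r he x₀ hZ fun hP => hk (by rw [← hw, hP]; exact strWeight_const_I),
    mul_zero]

/-- **S8 (the stabiliser-intersection count is `1` on every register).** `Σ_k V_k(C) = |𝒵 ∩ Φ_C⁻¹𝒵| = 1`
behind the sweep. [cite: FeffermanEtAl2023, §10 Remarks 20–22] -/
theorem sweep_profileMass_eq_one (r : ℝ) {d : ℕ} {e : Fin d → ι} (he : Function.Bijective e)
    (x₀ : ι → Bool) :
    ∑ k ∈ Finset.range (Fintype.card ι + 1), inputProfile r (xSweep e) x₀ k = 1 := by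
  simpa using sweep_certificate_eq_one r he x₀ 1

/-- The family `{1} ∪ {sweep} × m` of clean depth-`d` suffixes (member `0` = identity layers).
[cite: FeffermanEtAl2023, §10 Remark 22 (random gates in the last layers)] -/
noncomputable def sweepFam (m : ℕ) {d : ℕ} (e : Fin d → ι) :
    Fin (m + 1) → Fin d → Matrix (ι → Bool) (ι → Bool) ℂ :=
  fun j => if j = 0 then (fun _ => 1) else xSweep e

/-- Tracked paths of the family (constant behind the identity). [cite: FeffermanEtAl2023, §10 Remark 20] -/
def sweepFamPath (m : ℕ) {d : ℕ} (e : Fin d → ι) : Fin (m + 1) → (ι → Pauli) → Fin (d + 1) → ι → Pauli :=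
  fun j P => if j = 0 then (fun _ => P) else sweepPath e P

/-- Phases of the family. [cite: KempeEtAl2010, §2] -/
def sweepFamPhase (m : ℕ) {d : ℕ} (e : Fin d → ι) : Fin (m + 1) → (ι → Pauli) → Fin d → ℂ :=
  fun j P t => if j = 0 then 1 else xPhase (P (e t))

/-- The family's layers are unitary. [cite: KempeEtAl2010, §2] -/
theorem sweepFam_unitary (m : ℕ) {d : ℕ} (e : Fin d → ι) :
    ∀ j t, sweepFam m e j t ∈ Matrix.unitaryGroup (ι → Bool) ℂ := by
  intro j t
  by_cases hj : j = 0
  · simp only [sweepFam, hj, if_true]; exact Submonoid.one_mem _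
  · simp only [sweepFam, hj, if_false]; exact xSweep_unitary e t

/-- **S8 (UNIFORM DIAGONAL HITS ON EVERY REGISTER).** In `{1} ∪ {sweep} × m` every non-identity diagonal
string keeps a diagonal image for exactly `b = 1` member (the identity): `b/|J| = 1/(m+1)`; at
`m = 2ⁿ` this is the two-sided-coset ratio `1/(2ⁿ+1)` of the uniform Clifford measure (remark).
[cite: FeffermanEtAl2023, §10 Remark 22] -/
theorem sweepFam_uniform_hits (m : ℕ) {d : ℕ} {e : Fin d → ι} (he : Function.Bijective e)
    (P : ι → Pauli) (hZ : ∀ i, P i = Pauli.I ∨ P i = Pauli.Z) (hP : P ≠ fun _ => Pauli.I) :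
    (Finset.univ.filter fun j => ∀ i, sweepFamPath m e j P (Fin.last d) i = Pauli.I ∨
      sweepFamPath m e j P (Fin.last d) i = Pauli.Z).card = 1 := by
  rw [Finset.card_eq_one]
  refine ⟨0, Finset.ext fun j => ?_⟩
  simp only [Finset.mem_filter, Finset.mem_univ, true_and, Finset.mem_singleton]
  constructor
  · intro h
    by_contra hj
    simp only [sweepFamPath, hj, if_false, sweepPath_last he.2] at h
    exact hP (eq_constI_of_vxLetter_diag hZ h)
  · rintro rfl
    simpa [sweepFamPath] using hZ

/-- **S8 (THE AVERAGED COUNT ON EVERY REGISTER).** `Σ_j Σ_k V_k(C_j) = (m+1) + (2ⁿ − 1)` for the family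
`{1} ∪ {sweep} × m` (identity `2ⁿ`, each sweep `1`). [cite: FeffermanEtAl2023, §10 Remark 22; DalzellHunterJonesBrandao2022, Theorem 1] -/
theorem sweepFam_profileMass (m : ℕ) {d : ℕ} {e : Fin d → ι} (he : Function.Bijective e) (x₀ : ι → Bool) :
    ∑ j, ∑ k ∈ Finset.range (Fintype.card ι + 1), inputProfile 0 (sweepFam m e j) x₀ k =
      ((m + 1 : ℕ) : ℝ) + 1 * ((2 : ℝ) ^ Fintype.card ι - 1) := by
  have h := family_profileMass (sweepFam m e) x₀ (sweepFamPath m e) (sweepFamPhase m e)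
    (fun j P => by
      by_cases hj : j = 0
      · simp [sweepFamPath, hj]
      · simp [sweepFamPath, hj, sweepPath_zero])
    (fun j P _ t => by
      by_cases hj : j = 0
      · simp [sweepFam, sweepFamPath, sweepFamPhase, hj]
      · simp only [sweepFam, sweepFamPath, sweepFamPhase, hj, if_false]
        exact sweepPath_conj he.1 P t)
    (fun j P _ t => by
      by_cases hj : j = 0
      · simp [sweepFamPhase, hj]
      · simp only [sweepFamPhase, hj, if_false]; exact norm_xPhase _)
    1 (fun P hZ hP => by convert sweepFam_uniform_hits m he P hZ hP)
    (fun j i => by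
      by_cases hj : j = 0
      · simp [sweepFamPath, hj]
      · simp [sweepFamPath, hj, sweepPath_last he.2, vxLetter])
  rw [h, Fintype.card_fin, Nat.cast_one]

/-- **S8 (AVERAGED CERTIFICATE ON EVERY REGISTER).** `Σ_j Ψ_{C_j}(q) ≤ (m+1) + q²(2ⁿ−1)`: member-averaged
first-moment certificate `≤ 1 + q²(2ⁿ−1)/(m+1)` behind `{1} ∪ {sweep} × m` — at `m = 2ⁿ` the value
`1 + q²(2ⁿ−1)/(2ⁿ+1) < 1 + q²` for every `n` (the Clifford-uniform value by orbit counting — remark),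
against `(1+q²)ⁿ` behind a diagonal suffix; the SIZE of the certificate only.
[cite: FeffermanEtAl2023, §10 Remark 22 and p. 16; DalzellHunterJonesBrandao2022, Theorem 1] -/
theorem sweepFam_avg_certificate_le (m : ℕ) {d : ℕ} {e : Fin d → ι} (he : Function.Bijective e)
    (x₀ : ι → Bool) {q : ℝ} (hq0 : 0 ≤ q) (hq1 : q ≤ 1) :
    ∑ j, ∑ k ∈ Finset.range (Fintype.card ι + 1), (q ^ 2) ^ k * inputProfile 0 (sweepFam m e j) x₀ k ≤
      ((m + 1 : ℕ) : ℝ) + q ^ 2 * ((2 : ℝ) ^ Fintype.card ι - 1) := by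
  have h := avg_certificate_le_of_mass (sweepFam m e) (sweepFam_unitary m e) x₀
    (sweepFam_profileMass m he x₀) hq0 hq1
  rw [Fintype.card_fin] at h
  linarith

/-- **S8 (the Clifford-uniform VALUE is attained by a typed family on every register).** With `m = 2ⁿ`
sweeps and one identity: `Σ_j Ψ_{C_j}(q) ≤ (2ⁿ+1) + q²(2ⁿ−1)`, i.e. an average certificate
`≤ 1 + q²·(2ⁿ−1)/(2ⁿ+1) < 1 + q²` for every `n` (that this number is also the uniform-Clifford average is an
orbit-counting remark, not typed). [cite: FeffermanEtAl2023, §10 Remark 22 and p. 16] -/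
theorem cliffordValue_avg_certificate_le {d : ℕ} {e : Fin d → ι} (he : Function.Bijective e)
    (x₀ : ι → Bool) {q : ℝ} (hq0 : 0 ≤ q) (hq1 : q ≤ 1) :
    ∑ j, ∑ k ∈ Finset.range (Fintype.card ι + 1),
        (q ^ 2) ^ k * inputProfile 0 (sweepFam (2 ^ Fintype.card ι) e j) x₀ k ≤
      ((2 : ℝ) ^ Fintype.card ι + 1) + q ^ 2 * ((2 : ℝ) ^ Fintype.card ι - 1) := by
  have h := sweepFam_avg_certificate_le (2 ^ Fintype.card ι) he x₀ hq0 hq1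
  simpa [Nat.cast_add, Nat.cast_pow] using h

end Sweep

/-- **S8 (relation to §4, no second object).** The two-qubit layer `V = R_{X⊗1}·R_{1⊗X}` of §4 is the
composite of the two layers of the sweep `(false, true)`: `V = xSweep e 0 · xSweep e 1`.
[cite: FeffermanEtAl2023, §10 Remark 22] -/
theorem vx_eq_sweep_comp :
    vx = xSweep (![false, true] : Fin 2 → Bool) 0 * xSweep (![false, true] : Fin 2 → Bool) 1 := by
  have h0 : xSite false = str2 Pauli.X Pauli.I := by funext i; cases i <;> rfl
  have h1 : xSite true = str2 Pauli.I Pauli.X := by funext i; cases i <;> rfl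
  simp only [vx, xSweep, Matrix.cons_val_zero, Matrix.cons_val_one, h0, h1]

end Literature.Computability.QuantumComplexity.PauliPath.DampingCleanSuffix.Extremes.StabilizerCount.Sweep
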